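import Literature.MathematicalPhysics.KineticTheory.HardSphereEulerLocalTheory
import Literature.Analysis.FluidPDE.CompressibleEulerWellPosedness
import HarnessLib

/-!
# Local theory of the hard-sphere Euler system: reduction of `hsEuler_localExistence` and
# `hsEuler_continuation` to Majda's well-posedness theorem for athermal pressure laws

MathematicalPhysics/KineticTheory proof file (theorems only; no definitions, no named facts),
sibling of `HardSphereEulerLocalTheory.lean` (and of `HardSphereEulerLocalTheoryProofs.lean`,
which carries Step 0 of a from-scratch proof), whose two named facts render C. M. Dafermos,
*Hyperbolic Conservation Laws in Continuum Physics* (2nd ed., 2005), Ch. V, Thm 5.1.1 (p. 122 of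
the held text: existence of the classical solution on a maximal interval `[0, T_∞)`, with the
blow-up alternative (5.1.4); maximality from (5.1.25) and Grönwall, p. 126; §5.4, p. 139: "a
complete proof of (a slight variation of) Theorem 5.1.1 is contained in Majda [3]") for the
`5 × 5` compressible Euler system of the hard-sphere gas on `𝕋³`:

* `hsEuler_localExistence` — the existence clause,
* `hsEuler_continuation` — the maximality clause in restart form (`C¹` bounds and a compact state
  region on `[0, T)` ⇒ the classical solution extends beyond `T`).

The same published theorem (in Majda's form: A. Majda 1984, Ch. 2, Thms 2.1–2.2 with Cor. 1–2) is
vendored in the tree ONCE, in greater generality, as the named fact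
`Literature.Analysis.FluidPDE.CompressibleEulerLocalWellPosedness`
(`Literature/Analysis/FluidPDE/CompressibleEulerWellPosedness.lean`): local existence (i) and
`C¹` continuation (ii) for the complete Euler system of a monatomic fluid with an arbitrary smooth
athermal pressure law `p = ρ θ ζ(ρ)`, `e = 3θ/2` (`CompressibleEuler.EulerEOS.monatomicExcess ζ f`),
on the hyperbolicity range `(ρ ζ)′ > 0`, for the solution notion
`CompressibleEuler.IsClassicalEulerSolution`, which is `IsHardSphereEulerSolution` field for field
with `hsPressure σ` replaced by `eos.p`. This file proves that both hard-sphere facts are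
COROLLARIES of that one fact (no new literature debt; when
`CompressibleEulerLocalWellPosedness_holds` lands, `hsEuler_localExistence_holds` and
`hsEuler_continuation_holds` are one-liners from the two theorems below):

* `hsEuler_localExistence_of_compressibleEulerLocalWellPosedness`,
* `hsEuler_continuation_of_compressibleEulerLocalWellPosedness`.

## The reduction (Dafermos' proof applied to the hard-sphere law; §§1–5 below)

1. *Bridge of solution notions* (§1). If `hsCompressibility = Z` on `[0, η₀']` and the packing
   `ρσ³` of the fields stays in `[0, η₀']`, then `(ρ, u, θ)` is a hard-sphere solution iff it is
   a classical solution for `monatomicExcess (fun r => Z (r σ³)) f`: the two pressure FIELDS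
   `y ↦ p(ρ(t,y), θ(t,y))` coincide as functions on the torus at each time, hence so do their
   torus gradients and the energy fluxes; no regularity of the (`deriv`-junk-valued)
   `hsCompressibility` outside `[0, η₀']` is used.
2. *Equation of state* (§2). Under the hypothesis of both facts — `hsExcessFreeEnergy = F` on
   `[0, η₀)` with `F` analytic on `(-η₀, η₀)` — the function `1 + η F′(η)` is smooth on the ball
   `(-η₀, η₀)`; multiplied by a bump function it becomes a globally smooth `Z` with
   `hsCompressibility = Z` on `[0, η₀/2]` (on `(0, η₀/2]` the two `deriv`s agree because the
   functions agree near the point; at `η = 0` both sides are `1`).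
3. *Hyperbolicity threshold* (§3). `Z(0) = 1`, so by continuity there is `η_c ∈ (0, η₀/2]` with
   `Z(η) + ηZ′(η) > 0` for `|η| ≤ η_c`; for `σ > 0` the rescaled law `ζ(r) = Z(rσ³)` then has
   `(rζ)′(r) = Z(η) + ηZ′(η) > 0`, `η = rσ³`, on the density range `(0, η_c/σ³)` — this is
   `∂p/∂ρ = θ (Z + ηZ′) > 0`, positivity of the Friedrichs symmetriser
   `diag(p_ρ/ρ, ρ, ρ, ρ, 3ρ/(2θ))`, i.e. convexity of the entropy `-ρ s` required by Thm 5.1.1.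
   The packing threshold of both facts is `η₁ = η_c/2`, chosen before `σ`.
4. *`C¹` bounds* (§4). The facts bound the partial derivatives `Torus.partialDeriv i`; Majda's
   fact bounds the operator norm of `Torus.fderiv`; `‖Df(x)‖ ≤ ∑ᵢ ‖∂ᵢf(x)‖ ≤ 3M`.
5. *Assembly* (§5). Apply clause (i), resp. (ii), of the fact to `ζ(r) = Z(rσ³)`, `ρ̄ = η_c/σ³`;
   all fields involved have packing in `[0, η_c] ⊆ [0, η₀/2]`, so the bridge applies both ways.

A Summits theorem file (`Summits/AtomisticToContinuum/HydrodynamicLimit/Theorems/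
ImplosionDichotomyDenseExcursionR2WellPosedness.lean`) carries the same bridge for a summit-side
twin of these facts; Literature may not import Summits (CONVENTIONS §2), so the ~100 lines of
bridge are re-proved here in the Literature namespace.

## Mathlib / tree search

Tree: `CompressibleEulerLocalWellPosedness`, `CompressibleEuler.IsClassicalEulerSolution`,
`CompressibleEuler.EulerEOS.monatomicExcess`, `Torus.IsSmoothSpaceTimeOn.isSmooth_slice`,
`Torus.partialDeriv_eq_fderiv_apply`, `Torus.IsSmooth.isContDiff`. Mathlib: `ContDiffBump`
(`one_of_mem_closedBall`, `zero_of_le_dist`, `contDiffAt`), `AnalyticOnNhd.deriv`,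
`AnalyticOnNhd.contDiffOn_of_completeSpace`, `Filter.EventuallyEq.deriv_eq`,
`ContinuousLinearMap.opNorm_le_bound`, `PiLp.norm_apply_le`, `OrthonormalBasis.sum_repr`.

## References

* C. M. Dafermos, *Hyperbolic Conservation Laws in Continuum Physics*, 2nd ed., Grundlehren 325,
  Springer 2005: Ch. V, §5.1, Thm 5.1.1 with (5.1.3)–(5.1.4) (p. 122), (5.1.24)–(5.1.25)
  (pp. 125–126); §5.4 (p. 139). [`Dafermos2005`]
* A. Majda, *Compressible Fluid Flow and Systems of Conservation Laws in Several Space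
  Variables*, Appl. Math. Sci. 53, Springer 1984: Ch. 2, §2.1, Thms 2.1–2.2 and Cor. 1–2; Ch. 1
  (symmetrisation of the Euler system of gas dynamics). [`Majda1984`]
-/

noncomputable section

open Set Filter
open _root_.Topology
open scoped ContDiff

namespace Literature.MathematicalPhysics.KineticTheory

open Literature.Analysis.FunctionSpaces
open Literature.Analysis.FluidPDE (CompressibleEulerLocalWellPosedness)
open Literature.Analysis.FluidPDE.CompressibleEuler (EulerEOS IsClassicalEulerSolution)

/-! ## §1 The bridge: hard-sphere solutions are classical `monatomicExcess` solutions below the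
threshold -/

section Bridge

variable {Z : ℝ → ℝ} {η₀ σ : ℝ}

/-- Below the threshold the two pressure laws give THE SAME pressure field: if
`hsCompressibility = Z` on `[0, η₀]` and the packing `ρ σ³` of the slice lies in `[0, η₀]`
everywhere, then `y ↦ (monatomicExcess (fun r => Z (r σ³)) f).p (ρ y) (θ y) = ρ θ Z(ρσ³)` equals
`y ↦ hsPressure σ (ρ y) (θ y) = ρ θ hsCompressibility(ρσ³)`. [folklore] -/
theorem monatomicExcess_pressureField_eq (f : ℝ → ℝ) (hEq : EqOn hsCompressibility Z (Icc 0 η₀))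
    {ρ θ : T3 → ℝ} (hρ : ∀ y, ρ y * σ ^ 3 ∈ Icc 0 η₀) :
    (fun y => (EulerEOS.monatomicExcess (fun r => Z (r * σ ^ 3)) f).p (ρ y) (θ y)) =
      fun y => hsPressure σ (ρ y) (θ y) := by
  funext y
  show ρ y * θ y * Z (ρ y * σ ^ 3) = ρ y * θ y * hsCompressibility (ρ y * σ ^ 3)
  rw [hEq (hρ y)]

/-- Below the threshold the two energy-flux fields `(E + p) u` agree (the total energy densities
`ρ(|u|²/2 + e)`, `e = 3θ/2`, and `totalEnergyDensity ρ u θ` agree definitionally). [folklore] -/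
theorem monatomicExcess_energyFlux_eq (f : ℝ → ℝ) (hEq : EqOn hsCompressibility Z (Icc 0 η₀))
    {ρ θ : T3 → ℝ} (u : T3 → V3) (hρ : ∀ y, ρ y * σ ^ 3 ∈ Icc 0 η₀) :
    (fun y => (ρ y * (‖u y‖ ^ 2 / 2 +
        (EulerEOS.monatomicExcess (fun r => Z (r * σ ^ 3)) f).e (ρ y) (θ y)) +
        (EulerEOS.monatomicExcess (fun r => Z (r * σ ^ 3)) f).p (ρ y) (θ y)) • u y) =
      fun y => (totalEnergyDensity (ρ y) (u y) (θ y) + hsPressure σ (ρ y) (θ y)) • u y := by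
  funext y
  show (ρ y * (‖u y‖ ^ 2 / 2 + 3 / 2 * θ y) + ρ y * θ y * Z (ρ y * σ ^ 3)) • u y =
    (ρ y * (‖u y‖ ^ 2 / 2 + 3 / 2 * θ y) + ρ y * θ y * hsCompressibility (ρ y * σ ^ 3)) • u y
  rw [hEq (hρ y)]

/-- **Bridge of solution notions.** If `hsCompressibility = Z` on `[0, η₀]` and the packing
`ρ σ³` of the fields stays in `[0, η₀]` on `[0, T) × 𝕋³`, then `(ρ, u, θ)` is a classical
hard-sphere Euler solution at reduced diameter `σ` on `[0, T)` (`IsHardSphereEulerSolution`,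
pressure `hsPressure σ`) iff it is a classical solution of the complete Euler system for the
equation of state `monatomicExcess (fun r => Z (r σ³)) f` (any excess free energy `f`: the
entropy does not enter the equations). The two structures agree field for field once the
pressure fields are identified (`monatomicExcess_pressureField_eq`). [folklore] -/
theorem isHardSphereEulerSolution_iff_isClassicalEulerSolution (f : ℝ → ℝ)
    (hEq : EqOn hsCompressibility Z (Icc 0 η₀)) {T : ℝ} {ρ θ : ℝ → T3 → ℝ} {u : ℝ → T3 → V3}
    (hρ : ∀ t ∈ Ico 0 T, ∀ y, ρ t y * σ ^ 3 ∈ Icc 0 η₀) :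
    IsHardSphereEulerSolution σ T ρ u θ ↔
      IsClassicalEulerSolution (EulerEOS.monatomicExcess (fun r => Z (r * σ ^ 3)) f) T ρ u θ := by
  -- the two total energy densities, as space–time fields, agree definitionally (`e = 3θ/2`)
  have hE : (fun s y => ρ s y * (‖u s y‖ ^ 2 / 2 +
      (EulerEOS.monatomicExcess (fun r => Z (r * σ ^ 3)) f).e (ρ s y) (θ s y))) =
      fun s y => totalEnergyDensity (ρ s y) (u s y) (θ s y) := rfl
  constructor
  · intro h
    refine ⟨h.smooth_density, h.smooth_velocity, h.smooth_temperature, h.density_pos,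
      h.temperature_pos, h.mass, fun t ht x => ?_, fun t ht x => ?_⟩
    · rw [monatomicExcess_pressureField_eq f hEq (hρ t ht)]
      exact h.momentum t ht x
    · rw [hE, monatomicExcess_energyFlux_eq f hEq (u t) (hρ t ht)]
      exact h.energy t ht x
  · intro h
    refine ⟨h.smooth_density, h.smooth_velocity, h.smooth_temperature, h.density_pos,
      h.temperature_pos, h.mass, fun t ht x => ?_, fun t ht x => ?_⟩
    · rw [← monatomicExcess_pressureField_eq f hEq (hρ t ht)]
      exact h.momentum t ht x
    · rw [← hE, ← monatomicExcess_energyFlux_eq f hEq (u t) (hρ t ht)]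
      exact h.energy t ht x

end Bridge

/-! ## §2 The equation of state: a globally smooth compressibility factor from the analytic
excess free energy -/

/-- Smooth globalisation by a bump function: a function `C^∞` on the ball `(-R, R)` agrees on
`[-R/2, R/2]` with a globally `C^∞` function (multiply by a `ContDiffBump` equal to `1` on the
closed ball of radius `R/2` and supported in the ball of radius `3R/4`). [folklore] -/
theorem exists_contDiff_eqOn_closedBall {g : ℝ → ℝ} {R : ℝ} (hR : 0 < R)
    (hg : ContDiffOn ℝ ∞ g (Metric.ball 0 R)) :
    ∃ G : ℝ → ℝ, ContDiff ℝ ∞ G ∧ EqOn g G (Metric.closedBall 0 (R / 2)) := by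
  let φ : ContDiffBump (0 : ℝ) := ⟨R / 2, 3 * R / 4, half_pos hR, by linarith⟩
  refine ⟨fun x => φ x * g x, ?_, fun x hx => ?_⟩
  · rw [contDiff_iff_contDiffAt]
    intro x
    by_cases hx : x ∈ Metric.ball (0 : ℝ) R
    · exact φ.contDiffAt.mul (hg.contDiffAt (Metric.isOpen_ball.mem_nhds hx))
    · have hx' : φ.rOut < dist x 0 := by
        have hR' : R ≤ dist x 0 := by simpa [Metric.mem_ball, not_lt] using hx
        show 3 * R / 4 < dist x 0
        linarith
      have hev : (fun y => φ y * g y) =ᶠ[𝓝 x] fun _ => 0 := by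
        have hopen : ∀ᶠ y in 𝓝 x, φ.rOut < dist y 0 :=
          (isOpen_lt continuous_const (continuous_id.dist continuous_const)).mem_nhds hx'
        filter_upwards [hopen] with y hy
        rw [φ.zero_of_le_dist hy.le, zero_mul]
      exact contDiffAt_const.congr_of_eventuallyEq hev
  · show g x = φ x * g x
    rw [φ.one_of_mem_closedBall hx, one_mul]

/-- **The equation-of-state input made smooth.** If the hard-sphere excess free energy agrees on
`[0, η₀)`, `η₀ > 0`, with a function `F` analytic on `(-η₀, η₀)` (virial analyticity at low
density — the standing hypothesis of `hsEuler_localExistence` / `hsEuler_continuation`), then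
there is a globally smooth `Z` with `hsCompressibility = Z` on `[0, η₀/2]`: `Z = 1 + η F′(η)` near
`[0, η₀/2]` (globalised by `exists_contDiff_eqOn_closedBall`); on `(0, η₀/2]` the derivatives of
`hsExcessFreeEnergy` and `F` agree because the functions agree near the point, and at `η = 0`
both sides are `1`, the `deriv`-junk being multiplied by `0`. [folklore] -/
theorem exists_contDiff_eqOn_hsCompressibility {η₀ : ℝ} (hη₀ : 0 < η₀) {F : ℝ → ℝ}
    (hF : AnalyticOnNhd ℝ F (Ioo (-η₀) η₀)) (hEq : EqOn hsExcessFreeEnergy F (Ico 0 η₀)) :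
    ∃ Z : ℝ → ℝ, ContDiff ℝ ∞ Z ∧ EqOn hsCompressibility Z (Icc 0 (η₀ / 2)) := by
  have hg : ContDiffOn ℝ ∞ (fun η => 1 + η * deriv F η) (Metric.ball 0 η₀) := by
    have hball : Metric.ball (0 : ℝ) η₀ = Ioo (-η₀) η₀ := by
      rw [Real.ball_eq_Ioo, zero_sub, zero_add]
    rw [hball]
    exact contDiffOn_const.add (contDiffOn_id.mul hF.deriv.contDiffOn_of_completeSpace)
  obtain ⟨G, hG, hGeq⟩ := exists_contDiff_eqOn_closedBall hη₀ hg
  refine ⟨G, hG, fun η hη => ?_⟩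
  have hηball : η ∈ Metric.closedBall (0 : ℝ) (η₀ / 2) := by
    rw [Metric.mem_closedBall, dist_zero_right, Real.norm_eq_abs, abs_of_nonneg hη.1]
    exact hη.2
  rw [← hGeq hηball]
  show 1 + η * deriv hsExcessFreeEnergy η = 1 + η * deriv F η
  rcases hη.1.eq_or_lt with h0 | hpos
  · subst h0
    simp
  · have hlt : η < η₀ := lt_of_le_of_lt hη.2 (half_lt_self hη₀)
    have hnhds : hsExcessFreeEnergy =ᶠ[𝓝 η] F :=
      hEq.eventuallyEq_of_mem (mem_of_superset (Ioo_mem_nhds hpos hlt) Ioo_subset_Ico_self)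
    rw [hnhds.deriv_eq]

/-! ## §3 The hyperbolicity threshold (convex entropy / positive symmetriser at small packing) -/

/-- **Hyperbolicity threshold.** For a smooth `Z` agreeing with `hsCompressibility` on
`[0, η₀]`, `η₀ > 0`, there is `η_c ∈ (0, η₀]` with `Z(η) + η Z′(η) > 0` for all `|η| ≤ η_c`
(continuity at `η = 0`, where the value is `Z(0) = hsCompressibility 0 = 1`). This is
`∂p/∂ρ = θ (Z + ηZ′)(ρσ³) > 0`, i.e. positivity of the Friedrichs symmetriser
`diag(p_ρ/ρ, ρ, ρ, ρ, 3ρ/(2θ))` of the system in the variables `(ρ, u, θ)` — the convex-entropy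
hypothesis of Dafermos' Thm 5.1.1 for the hard-sphere law at small packing.
[cite: Dafermos2005, Thm 5.1.1] -/
theorem exists_hyperbolicityThreshold {Z : ℝ → ℝ} {η₀ : ℝ} (hη₀ : 0 < η₀) (hZ : ContDiff ℝ ∞ Z)
    (hEq : EqOn hsCompressibility Z (Icc 0 η₀)) :
    ∃ η₁ : ℝ, 0 < η₁ ∧ η₁ ≤ η₀ ∧ ∀ η : ℝ, |η| ≤ η₁ → 0 < Z η + η * deriv Z η := by
  have hcont : Continuous fun η => Z η + η * deriv Z η :=
    hZ.continuous.add (continuous_id.mul (hZ.continuous_deriv (by simp)))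
  -- `Z(0) = hsCompressibility 0 = 1`: the excess term carries the factor `η = 0`
  have hZ0 : hsCompressibility 0 = 1 := by simp [hsCompressibility]
  have h0 : Z 0 + 0 * deriv Z 0 = 1 := by
    rw [zero_mul, add_zero, ← hEq ⟨le_rfl, hη₀.le⟩, hZ0]
  have hopen : IsOpen {η : ℝ | 0 < Z η + η * deriv Z η} := isOpen_lt continuous_const hcont
  have hmem : (0 : ℝ) ∈ {η : ℝ | 0 < Z η + η * deriv Z η} := by
    show 0 < Z 0 + 0 * deriv Z 0
    rw [h0]; exact one_pos
  obtain ⟨δ, hδ, hball⟩ := Metric.isOpen_iff.1 hopen 0 hmem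
  refine ⟨min η₀ (δ / 2), lt_min hη₀ (half_pos hδ), min_le_left _ _, fun η hη => hball ?_⟩
  rw [Metric.mem_ball, Real.dist_eq, sub_zero]
  exact lt_of_le_of_lt (hη.trans (min_le_right _ _)) (half_lt_self hδ)

/-- For `σ > 0` and `Z(η) + ηZ′(η) > 0` on `|η| ≤ η_c`, the rescaled law `ζ(r) = Z(rσ³)` is
hyperbolic on the density range `(0, η_c/σ³)`: `(r ζ(r))′ = Z(η) + ηZ′(η) > 0`, `η = rσ³`, there
(chain rule; this is the hypothesis of `CompressibleEulerLocalWellPosedness`). [folklore] -/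
theorem deriv_mul_comp_rescale_pos {Z : ℝ → ℝ} (hZ : ContDiff ℝ ∞ Z) {η₁ σ : ℝ} (hσ : 0 < σ)
    (hpos : ∀ η : ℝ, |η| ≤ η₁ → 0 < Z η + η * deriv Z η) :
    ∀ r ∈ Ioo 0 (η₁ / σ ^ 3), 0 < deriv (fun s => s * Z (s * σ ^ 3)) r := by
  intro r hr
  have hσ3 : 0 < σ ^ 3 := pow_pos hσ 3
  -- chain rule: `(s Z(sσ³))′(r) = Z(rσ³) + rσ³ Z′(rσ³)`
  have h1 : HasDerivAt (fun s => s * σ ^ 3) (σ ^ 3) r := hasDerivAt_mul_const (σ ^ 3)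
  have h2 : HasDerivAt (fun s => Z (s * σ ^ 3)) (deriv Z (r * σ ^ 3) * σ ^ 3) r :=
    ((hZ.differentiable (by simp)) (r * σ ^ 3)).hasDerivAt.comp r h1
  have h3 : HasDerivAt (fun s => s * Z (s * σ ^ 3))
      (1 * Z (r * σ ^ 3) + r * (deriv Z (r * σ ^ 3) * σ ^ 3)) r :=
    (hasDerivAt_id' r).fun_mul h2
  have hderiv : deriv (fun s => s * Z (s * σ ^ 3)) r =
      Z (r * σ ^ 3) + r * σ ^ 3 * deriv Z (r * σ ^ 3) := by
    rw [h3.deriv]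
    ring
  rw [hderiv]
  refine hpos (r * σ ^ 3) ?_
  rw [abs_of_nonneg (mul_nonneg hr.1.le hσ3.le)]
  exact ((lt_div_iff₀ hσ3).1 hr.2).le

/-! ## §4 `C¹` bounds: operator norm of the torus derivative against the partial derivatives -/

/-- `‖Df(x)‖ ≤ ∑ᵢ ‖∂ᵢ f(x)‖` for a `C¹` field on the torus: expand `v = ∑ᵢ vᵢ eᵢ`, use
`∂ᵢ f = Df[eᵢ]` (`Torus.partialDeriv_eq_fderiv_apply`) and `|vᵢ| ≤ ‖v‖`. (The same inequality is
`Torus.norm_fderiv_le_sum_norm_partialDeriv` of `LadyzhenskayaTorus.lean`, re-proved here to keep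
the Fourier stack out of the imports of this file.) [folklore] -/
theorem norm_torusFDeriv_le_sum_norm_partialDeriv {E : Type*} [NormedAddCommGroup E]
    [NormedSpace ℝ E] {f : T3 → E} (hf : Torus.IsContDiff 1 f) (x : T3) :
    ‖Torus.fderiv f x‖ ≤ ∑ i, ‖Torus.partialDeriv i f x‖ := by
  refine ContinuousLinearMap.opNorm_le_bound _ (Finset.sum_nonneg fun _ _ => norm_nonneg _)
    fun v => ?_
  have hv : (∑ i, v i • EuclideanSpace.single i (1 : ℝ)) = v := by
    simpa only [EuclideanSpace.basisFun_repr, EuclideanSpace.basisFun_apply] using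
      (EuclideanSpace.basisFun (Fin 3) ℝ).sum_repr v
  calc ‖Torus.fderiv f x v‖
      = ‖∑ i, v i • Torus.fderiv f x (EuclideanSpace.single i (1 : ℝ))‖ := by
        conv_lhs => rw [← hv]
        rw [map_sum]
        simp only [map_smul]
    _ ≤ ∑ i, ‖v i • Torus.fderiv f x (EuclideanSpace.single i (1 : ℝ))‖ := norm_sum_le _ _
    _ ≤ ∑ i, ‖v‖ * ‖Torus.partialDeriv i f x‖ := by
        refine Finset.sum_le_sum fun i _ => ?_
        rw [norm_smul, Torus.partialDeriv_eq_fderiv_apply hf i x]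
        exact mul_le_mul_of_nonneg_right (by simpa using PiLp.norm_apply_le v i) (norm_nonneg _)
    _ = (∑ i, ‖Torus.partialDeriv i f x‖) * ‖v‖ := by
        rw [← Finset.mul_sum, mul_comm]

/-- Componentwise `C¹` bounds give an operator-norm bound: if `‖∂ᵢ f(x)‖ ≤ M` for the three
partial derivatives of a smooth field on `𝕋³`, then `‖Df(x)‖ ≤ 3M`. [folklore] -/
theorem norm_torusFDeriv_le_three_mul {E : Type*} [NormedAddCommGroup E] [NormedSpace ℝ E]
    {f : T3 → E} (hf : Torus.IsSmooth f) (x : T3) {M : ℝ}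
    (hM : ∀ i : Fin 3, ‖Torus.partialDeriv i f x‖ ≤ M) : ‖Torus.fderiv f x‖ ≤ 3 * M :=
  calc ‖Torus.fderiv f x‖ ≤ ∑ i, ‖Torus.partialDeriv i f x‖ :=
        norm_torusFDeriv_le_sum_norm_partialDeriv (hf.isContDiff (by simp)) x
    _ ≤ ∑ _i : Fin 3, M := Finset.sum_le_sum fun i _ => hM i
    _ = 3 * M := by simp

/-! ## §5 The two hard-sphere facts from Majda's well-posedness fact -/

/-- **Dafermos Thm 5.1.1, existence clause, for the hard-sphere law — reduced to the tree's
Majda fact.** `CompressibleEulerLocalWellPosedness` (Majda 1984, Ch. 2, Thm 2.1, monatomic fluid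
with a smooth athermal pressure law on its hyperbolicity range) implies `hsEuler_localExistence`:
given `η₀` and the analytic `F`, take the smooth `Z` of `exists_contDiff_eqOn_hsCompressibility`
(`hsCompressibility = Z` on `[0, η₀/2]`), the threshold `η_c ≤ η₀/2` of
`exists_hyperbolicityThreshold`, and `η₁ = η_c/2`; for `σ > 0` apply clause (i) of the fact to
`ζ(r) = Z(rσ³)`, `ρ̄ = η_c/σ³` (`(rζ)′ > 0` on `(0, ρ̄)` by `deriv_mul_comp_rescale_pos`); data of
packing `≤ η₁ < η_c` have density `< ρ̄`, the solution produced keeps density `< ρ̄`, i.e. packing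
in `[0, η_c] ⊆ [0, η₀/2]`, so it is a hard-sphere solution by
`isHardSphereEulerSolution_iff_isClassicalEulerSolution`.
[cite: Dafermos2005, Thm 5.1.1] -/
theorem hsEuler_localExistence_of_compressibleEulerLocalWellPosedness
    (hLWP : CompressibleEulerLocalWellPosedness) : hsEuler_localExistence := by
  intro η₀ hη₀ F hF hEqF
  obtain ⟨Z, hZ, hEq⟩ := exists_contDiff_eqOn_hsCompressibility hη₀ hF hEqF
  obtain ⟨ηc, hηc, hηc₀, hpos⟩ := exists_hyperbolicityThreshold (half_pos hη₀) hZ hEq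
  refine ⟨ηc / 2, half_pos hηc, fun σ hσ ρ₀ θ₀ u₀ hρ₀ hθ₀ hu₀ hρ₀pos hθ₀pos hpack => ?_⟩
  have hσ3 : 0 < σ ^ 3 := pow_pos hσ 3
  have hζs : ContDiff ℝ ∞ (fun r => Z (r * σ ^ 3)) := hZ.comp (contDiff_id.mul contDiff_const)
  obtain ⟨hloc, -⟩ := hLWP (fun r => Z (r * σ ^ 3)) (fun _ => 0) (ηc / σ ^ 3) hζs
    (div_pos hηc hσ3) (deriv_mul_comp_rescale_pos hZ hσ hpos)
  have hdata : ∀ x, ρ₀ x < ηc / σ ^ 3 := fun x =>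
    (lt_div_iff₀ hσ3).2 (lt_of_le_of_lt (hpack x) (half_lt_self hηc))
  obtain ⟨T, hT, ρ, θ, u, hsol, hρ0, hu0, hθ0, hlt⟩ :=
    hloc ρ₀ θ₀ u₀ hρ₀ hθ₀ hu₀ hρ₀pos hdata hθ₀pos
  have hpk : ∀ t ∈ Ico 0 T, ∀ y, ρ t y * σ ^ 3 ∈ Icc 0 (η₀ / 2) := fun t ht y =>
    ⟨mul_nonneg (hsol.density_pos t ht y).le hσ3.le,
      (((lt_div_iff₀ hσ3).1 (hlt t ht y)).le).trans hηc₀⟩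
  exact ⟨T, hT, ρ, θ, u,
    (isHardSphereEulerSolution_iff_isClassicalEulerSolution (fun _ => 0) hEq hpk).2 hsol,
    hρ0, hu0, hθ0⟩

/-- **Dafermos Thm 5.1.1, maximality clause (5.1.4) in restart form, for the hard-sphere law —
reduced to the tree's Majda fact.** `CompressibleEulerLocalWellPosedness` (Majda 1984, Ch. 2,
Thm 2.2 with Cor. 1–2: the classical solution continues as long as it stays in a compact part of
state space with bounded first derivatives) implies `hsEuler_continuation`: with `Z`, `η_c` and
`η₁ = η_c/2` as in `hsEuler_localExistence_of_compressibleEulerLocalWellPosedness`, a hard-sphere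
solution on `[0, T)` with packing `≤ η₁` is a classical `monatomicExcess (fun r => Z (rσ³))`
solution (bridge), its state bounds `M⁻¹ ≤ ρ, θ ≤ M`, `|u| ≤ M`, `ρ ≤ η₁/σ³ < ρ̄ = η_c/σ³` and
`|∂ᵢ(ρ, u, θ)| ≤ M` give the hypothesis of clause (ii) with the constant `3M`
(`norm_torusFDeriv_le_three_mul`), and the extension to `[0, T₂)`, `T₂ > T`, returned by the fact
keeps density `< ρ̄`, i.e. packing in `[0, η_c] ⊆ [0, η₀/2]`, so it is again a hard-sphere solution,
agreeing with the given one on `[0, T)`. [cite: Dafermos2005, Thm 5.1.1] -/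
theorem hsEuler_continuation_of_compressibleEulerLocalWellPosedness
    (hLWP : CompressibleEulerLocalWellPosedness) : hsEuler_continuation := by
  intro η₀ hη₀ F hF hEqF
  obtain ⟨Z, hZ, hEq⟩ := exists_contDiff_eqOn_hsCompressibility hη₀ hF hEqF
  obtain ⟨ηc, hηc, hηc₀, hpos⟩ := exists_hyperbolicityThreshold (half_pos hη₀) hZ hEq
  refine ⟨ηc / 2, half_pos hηc, fun σ hσ T M hT hM ρ θ u hE hB => ?_⟩
  have hσ3 : 0 < σ ^ 3 := pow_pos hσ 3
  have hζs : ContDiff ℝ ∞ (fun r => Z (r * σ ^ 3)) := hZ.comp (contDiff_id.mul contDiff_const)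
  obtain ⟨-, hcont⟩ := hLWP (fun r => Z (r * σ ^ 3)) (fun _ => 0) (ηc / σ ^ 3) hζs
    (div_pos hηc hσ3) (deriv_mul_comp_rescale_pos hZ hσ hpos)
  have hpk : ∀ t ∈ Ico 0 T, ∀ y, ρ t y * σ ^ 3 ∈ Icc 0 (η₀ / 2) := fun t ht y =>
    ⟨mul_nonneg (hE.density_pos t ht y).le hσ3.le,
      (hB t ht y).2.2.2.2.2.1.trans ((half_le_self hηc.le).trans hηc₀)⟩
  have hsol : IsClassicalEulerSolution
      (EulerEOS.monatomicExcess (fun r => Z (r * σ ^ 3)) fun _ => 0) T ρ u θ :=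
    (isHardSphereEulerSolution_iff_isClassicalEulerSolution (fun _ => 0) hEq hpk).1 hE
  have hbounds : ∃ M' ρ₁ : ℝ, ρ₁ < ηc / σ ^ 3 ∧ ∀ t ∈ Ico 0 T, ∀ x,
      M'⁻¹ ≤ ρ t x ∧ ρ t x ≤ ρ₁ ∧ M'⁻¹ ≤ θ t x ∧ θ t x ≤ M' ∧ ‖u t x‖ ≤ M' ∧
      ‖Torus.fderiv (ρ t) x‖ ≤ M' ∧ ‖Torus.fderiv (u t) x‖ ≤ M' ∧
      ‖Torus.fderiv (θ t) x‖ ≤ M' := by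
    refine ⟨3 * M, ηc / 2 / σ ^ 3, div_lt_div_of_pos_right (half_lt_self hηc) hσ3,
      fun t ht x => ?_⟩
    obtain ⟨h1, -, h3, h4, h5, h6, h7⟩ := hB t ht x
    have hM3 : M ≤ 3 * M := by linarith
    have hinv : (3 * M)⁻¹ ≤ M⁻¹ := inv_anti₀ hM hM3
    refine ⟨hinv.trans h1, (le_div_iff₀ hσ3).2 h6, hinv.trans h3, h4.trans hM3, h5.trans hM3,
      ?_, ?_, ?_⟩
    · refine norm_torusFDeriv_le_three_mul (hE.smooth_density.isSmooth_slice ht) x fun i => ?_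
      rw [Real.norm_eq_abs]
      exact (h7 i).2.1
    · exact norm_torusFDeriv_le_three_mul (hE.smooth_velocity.isSmooth_slice ht) x
        fun i => (h7 i).1
    · refine norm_torusFDeriv_le_three_mul (hE.smooth_temperature.isSmooth_slice ht) x
        fun i => ?_
      rw [Real.norm_eq_abs]
      exact (h7 i).2.2
  obtain ⟨T₂, hT₂, ρ', θ', u', hsol', hagree, hlt⟩ := hcont T hT ρ θ u hsol hbounds
  have hpk' : ∀ t ∈ Ico 0 T₂, ∀ y, ρ' t y * σ ^ 3 ∈ Icc 0 (η₀ / 2) := fun t ht y =>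
    ⟨mul_nonneg (hsol'.density_pos t ht y).le hσ3.le,
      (((lt_div_iff₀ hσ3).1 (hlt t ht y)).le).trans hηc₀⟩
  exact ⟨T₂, hT₂, ρ', θ', u',
    (isHardSphereEulerSolution_iff_isClassicalEulerSolution (fun _ => 0) hEq hpk').2 hsol',
    hagree⟩

end Literature.MathematicalPhysics.KineticTheory

end
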